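import Literature.AlgebraicGeometry.Resolution.NodeLocalStructureAlgebra
import Literature.AlgebraicGeometry.Resolution.AlterationsNodalStructure
import Literature.AlgebraicGeometry.Resolution.AlterationsSingGenerization
import Literature.AlgebraicGeometry.Resolution.AlterationsSingFittingProofs
import Literature.AlgebraicGeometry.Resolution.SmoothOfRegularFibre
import Literature.AlgebraicGeometry.Resolution.AlterationsFormalNodesSingProofs
import Literature.AlgebraicGeometry.Resolution.AlterationsFormalNodesPresentation
import Literature.AlgebraicGeometry.Resolution.AlterationsFormalCoordinates
import Literature.AlgebraicGeometry.Resolution.NodalFamilyRingDomain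
import Literature.AlgebraicGeometry.Resolution.AdicCompletionRegular
import HarnessLib

/-!
# De Jong 1996, 2.23 with 3.3: the complete local ring of a semi-stable curve at a singular
# closed point — proof of `DeJong1996NodeLocalStructure`

Topic: `Literature/AlgebraicGeometry/Resolution`. Discharges the named fact
`DeJong1996NodeLocalStructure` of `AlterationsNodeLocalStructure.lean`:

> "2.23. … If `f` is a split semi-stable curve … The complete local ring of `X` at `x` is
> `B ≅ A⟦u, v⟧/(uv - h)` for some `h ∈ A`." (pp. 61–62)
> "3.3. … The singular locus of `f` traced on `Spec B` maps isomorphically to the closed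
> subscheme `V(h) ⊂ Spec A'`. By assumption we have `V(h) ⊂ V(t₁ ⋯ t_r)`. Therefore we see
> that `h = ε t₁^{n₁} … t_r^{n_r}`, `ε ∈ (A')^*` with `nᵢ ≥ 0` and `Σ nᵢ ≥ 2` (if `Σ nᵢ = 1`,
> then the point `x` is regular on `X`). We change `Q` into `ε⁻¹ Q`. Thus we have
> `B ≅ A'⟦u, v⟧/(Q - t₁^{n₁} … t_r^{n_r})`." (p. 63)

for the curve `f : X → Y` of a pair in Situation 4.23 over an algebraically closed field at a
closed point `x ∈ Sing(f)`. The inputs, all proved in the tree: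

* **2.23** (split case): `h₀ ∈ 𝔪_Â` and `e₀ : Â⟦u, v⟧/(uv - h₀) ≅ 𝒪̂_{X,x}` over `Â = 𝒪̂_{Y,f x}`
  (`DeJong1996.SemiStablePair.exists_ringEquiv_nodeDeformationRing`, `AlterationsNodalStructure.lean`,
  from Liu 2002, Lemma 10.3.20, `NodalDeformation.lean`);
* **"by assumption"** = 3.1, `f` smooth over `Y ∖ D`, on `Spec 𝒪_{X,x}`
  (`DeJong1996.SemiStablePair.exists_notMem_forall_mul_singFittingIdeal_eq_zero`,
  `AlterationsSingGenerization.lean`), and 2.21, `Sing(f) → S` unramified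
  (`DeJong1996SingUnramified_holds`);
* Cohen's `Â ≅ k⟦T₁, …, T_m⟧`, `t̂ᵢ ↦ Tᵢ` (`exists_ringEquiv_adicCompletion_stalk_mvPowerSeries`).

## The proof of "`V(h) ⊂ V(t₁ ⋯ t_r)`" (`DeJong1996.SemiStablePair.apply_mem_of_apply_mem`)

In Cohen coordinates `Â ≅ P = k⟦T⟧`, `h₀ ↦ h'`, let `𝔓 ⊂ P` be a prime with `h' ∈ 𝔓` and
suppose `∏_{i<r} Tᵢ ∉ 𝔓`. Put `𝔮 = ker (B = 𝒪_{X,x} → B̂ ≅ P⟦u, v⟧/(uv - h') → P/𝔓 → L)`,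
`L = Frac(P/𝔓)`, evaluating at `u = v = 0` (possible as `h' ∈ 𝔓`). Along this map the
coefficients of `u` and of `v` are two `A`-derivations `B → L`
(`DeJong1996.NodeDeformationRing.linCoeff`, `NodeLocalStructureAlgebra.lean`), whose matrix of
values on approximations `b₀, b₁ ∈ B` of `u, v` modulo `𝔪̂²` is `≡ 1 (mod 𝔪)`, hence invertible;
so `Ω_{B/A} ⊗ L` has dimension `≥ 2` and `Fitt₁(Ω_{B/A}) ⊆ 𝔮`
(`DeJong1996.NodeDeformationRing.fittingIdeal_le_ker_evalZeroFrac`: `𝔮 ∈ Sing(f)`). But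
`I(D)_{f x} 𝒪_{X,x} = (t₁ ⋯ t_r) ⊄ 𝔮`, so `𝔮` lies over `Y ∖ D`, where `f` is smooth: some
`s ∉ 𝔮` kills `Fitt₁(Ω_{B/A})`, whence `Fitt₁(Ω_{B/A}) = 0` (`B` is a domain), which 2.21
forbids at a point of `Sing(f)` (`𝔪_x ⊆ Fitt₁ + 𝔪_s 𝒪_{X,x}` would make the closed fibre at `x`
a reduced point, whose completion `k⟦u, v⟧/(uv)` is not a domain). Hence `(t₁ ⋯ t_r)ᴺ ∈ (h')`,
and `h' = ε ∏ Tᵢ^{nᵢ}` with `ε` a unit since the `Tᵢ` are prime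
(`exists_isUnit_mul_prod_pow_of_mul_eq_prod_pow`); "we change `Q` into `ε⁻¹Q`"
(`DeJong1996.NodeDeformationRing.unitScale`). Finally `Σ nᵢ ≥ 1` as `h₀` is not a unit, and
`𝒪_{X,x}` is regular iff `𝒪̂_{X,x} ≅ k⟦u, v, T⟧/(uv - ∏ Tᵢ^{nᵢ})` is, iff `Σ nᵢ = 1`
(`DeJong1996.FormalNodeRing.exists_eq_single_of_isRegularLocalRing`,
`DeJong1996.FormalNodeRing.isRegularLocalRing_single`).

(The Remark of 2.23, "the trace of `Sing(f)` on `Spec B` is given by the ideal `(u, v)`", i.e.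
the full computation `Fitt₁(Ω_{B/A}) B̂ = (u, v)`, is not needed for this.)

## Sources

* A. J. de Jong, *Smoothness, semi-stability and alterations*, Publ. Math. IHÉS 83 (1996),
  2.21–2.23 (pp. 61–62), 3.1–3.3 (pp. 62–63), 4.23–4.24 (p. 75). [DeJong1996]
* Q. Liu, *Algebraic Geometry and Arithmetic Curves* (2002), Lemma 10.3.20 (via
  `NodalDeformation.lean`).
-/

noncomputable section

open CategoryTheory CategoryTheory.Limits AlgebraicGeometry TopologicalSpace IsLocalRing

namespace Literature.AlgebraicGeometry.Resolution

universe u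

open Literature.RingTheory.FittingIdeal

/-! ## 3.3: `V(h) ⊆ V(t₁ ⋯ t_r)` in Cohen coordinates, and the factorisation of `h` -/

namespace DeJong1996.SemiStablePair

open Scheme.IdealSheafData NodalDeformation

variable {k : Type u} [Field k] {X Y : Scheme.{u}} {f : X ⟶ Y} {g : Y ⟶ Spec (.of k)}
  {D : Set Y} {n : ℕ} {τ : Fin n → (Y ⟶ X)}

/-- **2.21 at a point of `Sing(f)`: `Fitt₁(Ω_{X/Y})_x ≠ 0`.** At a closed point `x` of the curve of
a pair in Situation 4.23 (algebraically closed base field) at which `f` is not smooth, the first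
Fitting ideal of `Ω_{𝒪_{X,x}/𝒪_{Y,f x}}` is non-zero: were it `0`, unramifiedness of `Sing(f) → Y`
(2.21, `DeJong1996SingUnramified_holds`: `𝔪_x ⊆ Fitt₁ + 𝔪_{f x} 𝒪_{X,x}`) would give
`𝔪_x = 𝔪_{f x} 𝒪_{X,x}`, so the local ring of the fibre at `x` would be a field, with integral
completion — but that completion is `k⟦u, v⟧/(uv)` (2.21/2.23,
`nonempty_ringEquiv_fibreCompletion`). [cite: DeJong1996, 2.21, p. 61] -/
theorem singFittingIdeal_ne_bot [IsAlgClosed k] (hS : SemiStablePair f g D τ) {x : X}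
    (hx : IsClosed ({x} : Set X)) (hns : ∀ U : X.Opens, x ∈ U → ¬ Smooth (U.ι ≫ f)) :
    Scheme.Hom.singFittingIdeal f x ≠ ⊥ := by
  intro hbot
  have hsing := hS.not_isRegularLocalRing_stalk_fiber_of_not_smooth hx hns
  obtain ⟨efib⟩ := hS.nonempty_ringEquiv_fibreCompletion hx hsing
  set J : Ideal (X.presheaf.stalk x) :=
    (maximalIdeal (Y.presheaf.stalk (f x))).map (f.stalkMap x).hom with hJ
  -- 2.21: `𝔪_x ⊆ Fitt₁ + 𝔪_{f x} B = 𝔪_{f x} B`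
  have h1 := (DeJong1996SingUnramified_holds X Y f hS.isSemiStableCurve x
    (by rw [hbot]; exact bot_ne_top)).1
  rw [hbot, bot_sup_eq] at h1
  have hloc : IsLocalHom (f.stalkMap x).hom := inferInstance
  have hJle : J ≤ maximalIdeal (X.presheaf.stalk x) :=
    ((local_hom_TFAE (f.stalkMap x).hom).out 0 2).mp hloc
  have hJeq : J = maximalIdeal (X.presheaf.stalk x) := le_antisymm hJle h1
  -- so `B/J` is a field and the completion ideal is `0`
  haveI : J.IsMaximal := by rw [hJeq]; infer_instance
  haveI : IsDomain (X.presheaf.stalk x ⧸ J) := Ideal.Quotient.isDomain J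
  have hI : (maximalIdeal (X.presheaf.stalk x)).map (Ideal.Quotient.mk J) = ⊥ := by
    rw [Ideal.map_eq_bot_iff_le_ker, Ideal.mk_ker, hJeq]
  haveI := isDomain_adicCompletion_of_eq_bot hI
  exact IsOrdinaryDoublePoint.not_isDomain_quotient (ResidueField (Y.presheaf.stalk (f x)))
    (MulEquiv.isDomain _ efib.symm.toMulEquiv)

/-- **de Jong 1996, 3.3: "By assumption we have `V(h) ⊂ V(t₁ ⋯ t_r)`" — in Cohen coordinates.**
For the curve of a pair in Situation 4.23 over an algebraically closed field, a closed point `x`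
at which `f` is not smooth, the structure isomorphism `e₀ : Â⟦u, v⟧/(uv - h₀) ≅ 𝒪̂_{X,x}` of 2.23
over `Â = 𝒪̂_{Y,f x}`, Cohen coordinates `ι : Â ≅ P = k⟦T⟧`, and an element `ϖ ∈ 𝒪_{Y,f x}`
generating the stalk of the ideal of `D`: every prime `𝔓` of `P` containing `ι h₀` contains
`ι ϖ̂`. See the module docstring for the proof. [cite: DeJong1996, 3.3, p. 63] -/
theorem apply_mem_of_apply_mem [IsAlgClosed k] (hS : SemiStablePair f g D τ) {x : X}
    (hx : IsClosed ({x} : Set X)) (hns : ∀ U : X.Opens, x ∈ U → ¬ Smooth (U.ι ≫ f))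
    {h₀ : Cpl (Y.presheaf.stalk (f x))}
    (e₀ : NodeDeformationRing _ h₀ ≃+* Cpl (X.presheaf.stalk x))
    (hh₀ : ¬ IsUnit h₀)
    (he₀ : ∀ a, e₀ (Ideal.Quotient.mk _ (MvPowerSeries.C a)) = completedStalkMap f x a)
    {m : ℕ} (ι : Cpl (Y.presheaf.stalk (f x)) ≃+* MvPowerSeries (Fin m) k)
    {ϖ : Y.presheaf.stalk (f x)}
    (hϖ : stalkIdeal (vanishingIdeal ⟨D, hS.isStrictNormalCrossingsDivisor.isClosed⟩) (f x) =
      Ideal.span {ϖ})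
    (𝔓 : Ideal (MvPowerSeries (Fin m) k)) [𝔓.IsPrime] (hP : ι h₀ ∈ 𝔓) :
    ι (algebraMap _ _ ϖ) ∈ 𝔓 := by
  classical
  haveI := hS.isIntegral
  haveI := hS.isNoetherian
  haveI := hS.isNoetherian_base
  haveI := hS.isSemiStableCurve.locallyOfFinitePresentation
  haveI := hS.isSemiStableCurve.locallyOfFiniteType
  letI algAB : Algebra (Y.presheaf.stalk (f x)) (X.presheaf.stalk x) := (f.stalkMap x).hom.toAlgebra
  haveI : IsLocalHom (algebraMap (Y.presheaf.stalk (f x)) (X.presheaf.stalk x)) :=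
    inferInstanceAs (IsLocalHom (f.stalkMap x).hom)
  haveI : Algebra.EssFiniteType (Y.presheaf.stalk (f x)) (X.presheaf.stalk x) :=
    LocallyOfFiniteType.stalkMap f x
  haveI : IsDomain (MvPowerSeries (Fin m) k) := NoZeroDivisors.to_isDomain _
  -- the formal structure in Cohen coordinates, `Ψ : B̂ ≅ P⟦u, v⟧/(uv - h')`, `h' = ι h₀`
  let Ψ : Cpl (X.presheaf.stalk x) ≃+* NodeDeformationRing (MvPowerSeries (Fin m) k) (ι h₀) :=
    e₀.symm.trans (NodeDeformationRing.congr ι h₀ (ι h₀) rfl)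
  let ι' : Y.presheaf.stalk (f x) →+* MvPowerSeries (Fin m) k :=
    ι.toRingHom.comp (algebraMap (Y.presheaf.stalk (f x)) (Cpl (Y.presheaf.stalk (f x))))
  have hι' : ∀ a, ι' a = ι (algebraMap (Y.presheaf.stalk (f x)) (Cpl (Y.presheaf.stalk (f x))) a) :=
    fun _ => rfl
  have hΨ : ∀ a : Y.presheaf.stalk (f x),
      Ψ (algebraMap (X.presheaf.stalk x) (Cpl (X.presheaf.stalk x))
        (algebraMap (Y.presheaf.stalk (f x)) (X.presheaf.stalk x) a)) =
      Ideal.Quotient.mk _ (MvPowerSeries.C (ι' a)) := by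
    intro a
    have h1 : algebraMap (X.presheaf.stalk x) (Cpl (X.presheaf.stalk x))
        (algebraMap (Y.presheaf.stalk (f x)) (X.presheaf.stalk x) a) = e₀ (Ideal.Quotient.mk _
        (MvPowerSeries.C (algebraMap (Y.presheaf.stalk (f x)) (Cpl (Y.presheaf.stalk (f x))) a))) := by
      rw [he₀, AdicCompletion.algebraMap_apply, Algebra.algebraMap_self_apply,
        AdicCompletion.algebraMap_apply, Algebra.algebraMap_self_apply, RingHom.algebraMap_toAlgebra,
        completedStalkMap_of]
    change NodeDeformationRing.congr ι h₀ (ι h₀) rfl (e₀.symm (algebraMap (X.presheaf.stalk x)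
      (Cpl (X.presheaf.stalk x)) (algebraMap (Y.presheaf.stalk (f x)) (X.presheaf.stalk x) a))) = _
    rw [h1, RingEquiv.symm_apply_apply, NodeDeformationRing.congr_mk_C]
    rfl
  have hm : ι h₀ ∈ maximalIdeal (MvPowerSeries (Fin m) k) := by
    rw [mem_maximalIdeal, mem_nonunits_iff]
    exact fun hu => hh₀ (by simpa using hu.map ι.symm)
  by_contra hϖP
  -- the prime `𝔮 = ker χ` contains `Fitt₁`
  let χ := NodeDeformationRing.evalZeroFrac Ψ 𝔓 hP
  have hFitt : Scheme.Hom.singFittingIdeal f x ≤ RingHom.ker χ :=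
    NodeDeformationRing.fittingIdeal_le_ker_evalZeroFrac Ψ ι' hΨ hm 𝔓 hP
  haveI : (RingHom.ker χ).IsPrime := RingHom.ker_isPrime χ
  -- `I(D)_{f x} B = (ϖ) ⊄ 𝔮`
  have hχϖ : χ (algebraMap (Y.presheaf.stalk (f x)) (X.presheaf.stalk x) ϖ) ≠ 0 := by
    intro h0
    rw [NodeDeformationRing.evalZeroFrac_apply, hΨ, NodeDeformationRing.ccBar_mk,
      MvPowerSeries.constantCoeff_C] at h0
    have h0' : Ideal.Quotient.mk 𝔓 (ι' ϖ) = 0 :=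
      (IsFractionRing.injective (MvPowerSeries (Fin m) k ⧸ 𝔓)
        (FractionRing (MvPowerSeries (Fin m) k ⧸ 𝔓))) (by rw [h0, map_zero])
    rw [Ideal.Quotient.eq_zero_iff_mem, hι'] at h0'
    exact hϖP h0'
  have hD : ¬ (stalkIdeal (vanishingIdeal ⟨D, hS.isStrictNormalCrossingsDivisor.isClosed⟩) (f x)).map
      (f.stalkMap x).hom ≤ RingHom.ker χ := by
    rw [hϖ, Ideal.map_span, Set.image_singleton, Ideal.span_singleton_le_iff_mem, RingHom.mem_ker]
    exact hχϖ
  -- so some `s ∉ 𝔮` kills `Fitt₁`, i.e. `Fitt₁ = 0` (`B` is a domain): contradiction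
  obtain ⟨s, hs, hsa⟩ := hS.exists_notMem_forall_mul_singFittingIdeal_eq_zero (RingHom.ker χ) hFitt hD
  have hs0 : s ≠ 0 := fun h0 => hs (by rw [h0]; exact Ideal.zero_mem _)
  refine hS.singFittingIdeal_ne_bot hx hns ((Submodule.eq_bot_iff _).mpr fun a ha => ?_)
  exact (mul_eq_zero.mp (hsa a ha)).resolve_left hs0

end DeJong1996.SemiStablePair

/-! ## The theorem -/

set_option maxHeartbeats 400000 in
open Scheme.IdealSheafData NodalDeformation DeJong1996 in
/-- **de Jong 1996, 2.23 with 3.3 (split case) — the named fact `DeJong1996NodeLocalStructure`,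
PROVED.** For the curve `f : X → Y` of a pair in Situation 4.23 over an algebraically closed
field, a closed point `x` lying in no open on which `f` is smooth, and local equations
`t₁, …, t_r` of the branches of `D` at `f x` completed by `y₁, …, y_e` to a regular system of
parameters: there are exponents `nᵢ` and an isomorphism
`𝒪̂_{X,x} ≅ 𝒪̂_{Y,f x}⟦u, v⟧/(uv - t̂₁^{n₁} ⋯ t̂_r^{n_r})` over `𝒪̂_{Y,f x}`, with `Σ nᵢ ≥ 1`, and
`𝒪_{X,x}` is regular iff `Σ nᵢ = 1`. See the module docstring for the proof.
[cite: DeJong1996, 2.23 and 3.3, pp. 61–63] -/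
theorem DeJong1996NodeLocalStructure_holds : DeJong1996NodeLocalStructure.{u} := by
  intro k _ _ X Y f g D n τ hS x hx hns r e t y hr hdim hspan hdiv
  classical
  haveI := hS.isIntegral
  haveI := hS.isNoetherian
  haveI := hS.isNoetherian_base
  haveI := hS.locallyOfFiniteType
  haveI : IsProper g :=
    Literature.AlgebraicGeometry.Motives.IsProjectiveOver.isProper (X := Over.mk g)
      hS.isProjectiveOver_base
  have hy : IsClosed ({f x} : Set Y) := hS.isClosed_image hx
  haveI : IsRegularLocalRing (Y.presheaf.stalk (f x)) := hS.isRegular_base (f x)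
  haveI : IsDomain (MvPowerSeries (Fin (r + e)) k) := NoZeroDivisors.to_isDomain _
  -- 2.23 (split case)
  have hsing := hS.not_isRegularLocalRing_stalk_fiber_of_not_smooth hx hns
  obtain ⟨h₀, e₀, hh₀, he₀⟩ := hS.exists_ringEquiv_nodeDeformationRing hx hsing
  -- Cohen coordinates `ι : Â ≅ k⟦T₁, …, T_{r+e}⟧` adapted to `(t, y)`
  have hzspan : Ideal.span (Set.range (Fin.append t y)) = maximalIdeal (Y.presheaf.stalk (f x)) := by
    rw [range_fin_append, hspan]
  obtain ⟨ι, hι⟩ :=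
    exists_ringEquiv_adicCompletion_stalk_mvPowerSeries g hy (Fin.append t y) hzspan hdim
  have hιt : ∀ i : Fin r, ι (algebraMap (Y.presheaf.stalk (f x)) (Cpl (Y.presheaf.stalk (f x))) (t i)) =
      MvPowerSeries.X (Fin.castAdd e i) := by
    intro i
    rw [← hι (Fin.castAdd e i), Fin.append_left]
  -- the stalk of the ideal of `D` is generated by `∏ tᵢ`
  have hϖ : stalkIdeal (vanishingIdeal ⟨D, hS.isStrictNormalCrossingsDivisor.isClosed⟩) (f x) =
      Ideal.span {∏ i, t i} := by
    obtain ⟨_, ⟨U, hU, rfl⟩, hxU, -⟩ :=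
      Y.isBasis_affineOpens.exists_subset_of_mem_open (Set.mem_univ (f x)) isOpen_univ
    have hcl : (⟨closure D, isClosed_closure⟩ : Closeds Y) =
        ⟨D, hS.isStrictNormalCrossingsDivisor.isClosed⟩ :=
      Closeds.ext hS.isStrictNormalCrossingsDivisor.isClosed.closure_eq
    rw [stalkIdeal_eq_map_germ _ ⟨U, hU⟩ hxU, ← hcl]
    exact hdiv ⟨U, hU⟩ hxU
  -- 3.3: `V(h') ⊆ V(∏ Tᵢ)`, so `(∏ Tᵢ)ᴺ ∈ (h')` and `h' = ε' ∏ Tᵢ^{mᵢ}` (`h' = ι h₀`)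
  have hιϖ : ι (algebraMap (Y.presheaf.stalk (f x)) (Cpl (Y.presheaf.stalk (f x))) (∏ i, t i)) =
      ∏ i, (MvPowerSeries.X (Fin.castAdd e i) : MvPowerSeries (Fin (r + e)) k) := by
    rw [map_prod, map_prod]
    exact Finset.prod_congr rfl fun i _ => hιt i
  have key : ∀ 𝔓 : Ideal (MvPowerSeries (Fin (r + e)) k), 𝔓.IsPrime → ι h₀ ∈ 𝔓 →
      (∏ i, (MvPowerSeries.X (Fin.castAdd e i) : MvPowerSeries (Fin (r + e)) k)) ∈ 𝔓 := by
    intro 𝔓 h𝔓 hP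
    rw [← hιϖ]
    exact hS.apply_mem_of_apply_mem hx hns e₀ hh₀ he₀ ι hϖ 𝔓 hP
  obtain ⟨N, hN⟩ := exists_pow_mem_span_singleton_of_forall_isPrime key
  obtain ⟨c, hc⟩ := Ideal.mem_span_singleton'.mp hN
  obtain ⟨mexp, ε', hε', hfac⟩ := exists_isUnit_mul_prod_pow_of_mul_eq_prod_pow
    (Finset.univ : Finset (Fin r))
    (fun i => (MvPowerSeries.X (Fin.castAdd e i) : MvPowerSeries (Fin (r + e)) k))
    (fun i _ => MvPowerSeries.prime_X' k (Fin.castAdd e i)) N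
    (x := ι h₀) (y := c) (by rw [← hc, mul_comm])
  -- back to `Â`: `h₀ = ε ∏ t̂ᵢ^{mᵢ}`
  set p₀ : Cpl (Y.presheaf.stalk (f x)) :=
    ∏ i, algebraMap (Y.presheaf.stalk (f x)) (Cpl (Y.presheaf.stalk (f x))) (t i) ^ mexp i with hp₀
  have hιp₀ : ι p₀ = ∏ i, (MvPowerSeries.X (Fin.castAdd e i) : MvPowerSeries (Fin (r + e)) k) ^ mexp i := by
    rw [hp₀, map_prod]
    exact Finset.prod_congr rfl fun i _ => by rw [map_pow, hιt]
  have hεu : IsUnit (ι.symm ε') := hε'.map ι.symm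
  set εu : (Cpl (Y.presheaf.stalk (f x)))ˣ := hεu.unit with hεudef
  have hh₀fac : h₀ = εu * p₀ := by
    apply ι.injective
    rw [map_mul, hιp₀, hεudef, IsUnit.unit_spec, RingEquiv.apply_symm_apply, hfac]
  -- the isomorphism: `e₀⁻¹`, then "change `Q` into `ε⁻¹ Q`"
  let e₁ : NodeDeformationRing (Cpl (Y.presheaf.stalk (f x))) h₀ ≃+*
      NodeDeformationRing (Cpl (Y.presheaf.stalk (f x))) ((εu : Cpl (Y.presheaf.stalk (f x))) * p₀) :=
    NodeDeformationRing.congr (RingEquiv.refl _) h₀ _ hh₀fac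
  let eF : Cpl (X.presheaf.stalk x) ≃+* NodeDeformationRing (Cpl (Y.presheaf.stalk (f x))) p₀ :=
    e₀.symm.trans (e₁.trans (NodeDeformationRing.unitScale εu p₀))
  have heF : ∀ a, eF (completedStalkMap f x a) = Ideal.Quotient.mk _ (MvPowerSeries.C a) := by
    intro a
    change NodeDeformationRing.unitScale εu p₀ (e₁ (e₀.symm (completedStalkMap f x a))) = _
    rw [← he₀ a, RingEquiv.symm_apply_apply]
    change NodeDeformationRing.unitScale εu p₀ (NodeDeformationRing.congr (RingEquiv.refl _) h₀ _ hh₀fac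
      (Ideal.Quotient.mk _ (MvPowerSeries.C a))) = _
    rw [NodeDeformationRing.congr_mk_C, RingEquiv.refl_apply, NodeDeformationRing.unitScale_mk_C]
  have hp₀eq : p₀ = ∏ i, AdicCompletion.of _ _ (t i) ^ mexp i := by
    rw [hp₀]
    exact Finset.prod_congr rfl fun i _ => by
      rw [AdicCompletion.algebraMap_apply, Algebra.algebraMap_self_apply]
  -- the comparison with the formal node ring `k⟦u, v, T⟧/(uv - ∏ Tⱼ^{νⱼ})`, `ν = (m, 0)`
  set ν : Fin (r + e) → ℕ := Fin.append mexp (0 : Fin e → ℕ) with hν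
  have hιν : ι p₀ = ∏ j, (MvPowerSeries.X j : MvPowerSeries (Fin (r + e)) k) ^ ν j := by
    rw [hιp₀, hν, prod_pow_fin_append_zero]
  let E : Cpl (X.presheaf.stalk x) ≃+* FormalNodeRing k (r + e) ν :=
    eF.trans ((NodeDeformationRing.congr ι p₀ _ hιν).trans (NodeDeformationRing.toFormalNodeRing k (r + e) ν))
  have hsumν : ∑ j, ν j = ∑ i, mexp i := by rw [hν, sum_fin_append_zero]
  -- assemble
  have hcomp := NodeDeformationRing.trans_congr_refl_comp_eq_ofBase (completedStalkMap f x) eF heF hp₀eq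
  refine ⟨mexp, eF.trans (NodeDeformationRing.congr (RingEquiv.refl _) p₀ _ hp₀eq), hcomp, ?_, ?_⟩
  · -- `Σ mᵢ ≥ 1`: `h₀` is not a unit
    by_contra hlt
    have h0 : ∀ i, mexp i = 0 := fun i => by
      have := Finset.single_le_sum (fun j _ => Nat.zero_le (mexp j)) (Finset.mem_univ i)
      omega
    have hp1 : p₀ = 1 := by
      rw [hp₀]
      exact Finset.prod_eq_one fun i _ => by rw [h0 i, pow_zero]
    rw [hp1, mul_one] at hh₀fac
    exact hh₀ (hh₀fac ▸ Units.isUnit εu)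
  · -- `𝒪_{X,x}` regular iff `Σ mᵢ = 1`
    constructor
    · intro hreg
      haveI := hreg
      haveI : IsRegularLocalRing (Cpl (X.presheaf.stalk x)) :=
        isRegularLocalRing_adicCompletion (X.presheaf.stalk x)
      obtain ⟨i₀, hi₀, -⟩ := DeJong1996.FormalNodeRing.exists_eq_single_of_isRegularLocalRing E
      rw [← hsumν, hi₀, Finset.sum_pi_single']
      simp
    · intro hsum
      have hν1 : ∑ j, ν j = 1 := by rw [hsumν, hsum]
      have hνne : ∃ j, ν j ≠ 0 := by
        by_contra hall
        push Not at hall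
        rw [Finset.sum_eq_zero (fun j _ => hall j)] at hν1
        exact zero_ne_one hν1
      obtain ⟨i₀, hi₀⟩ := DeJong1996.FormalNodeRing.eq_single_of_sum_le_one hνne hν1.le
      have hregF : IsRegularLocalRing (FormalNodeRing k (r + e) ν) := by
        rw [hi₀]
        exact DeJong1996.FormalNodeRing.isRegularLocalRing_single k i₀
      haveI : IsRegularLocalRing (Cpl (X.presheaf.stalk x)) := IsRegularLocalRing.of_ringEquiv E.symm
      exact isRegularLocalRing_of_isRegularLocalRing_adicCompletion ‹_›

end Literature.AlgebraicGeometry.Resolution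

end
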